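import Summits.Ventures.Crystal3D.Theorems.StickyWulffConstantGenericWallFloorStackLedgerOffReach
import Summits.Ventures.Crystal3D.Theorems.StickyWulffConstantGenericWallFloorCoreResidual
import HarnessLib

/-!
# `GenericWallFloor` per pair for EVERY relative translation off the registry set — the generic branch of the arrival
# case split (crux `GenericWallFloor`, stmt-Ventures-19480, line `WallLedgerG`)

HONEST FRAMING. Venture `Summits/Ventures/Crystal3D` (cell `crystal3d-full`), helper `--supports` the crux
`GenericWallFloor` of `route-Ventures-StickyWulffConstant`, REGISTERED line `WallLedgerG`, open stub
`stub_twoSlabAdhesion`.  Rung credit only; F-C1 not moved; NOT the crux: `ExactOnly`(C12-55) [E1] and `StarPairFar`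
[certified] stay BY NAME, and the REGISTERED relative translations are not covered.

THE STATEMENT.  Fix the two frames `A₁`, `A₂` (ANY — co-axial or not, chain or not) and steep slots `u₁` (grain 1, up),
`u₂` (grain 2, down).  The REGISTRY SET of the pair is
`𝓡 = A₁·Λ₀ + A₂·Λ₀ + reachGroup M₁ + reachGroup M₂` with `Mᵢ` any frame set containing the frames of all sound well-formed
stacks over the two bottoms — e.g. the forced-ray sets `chainFrames (±e₃) Aᵢ uᵢ` (two admissible normals × ℕ frames each,
so `𝓡` is countable).  **For every `t₁, t₂` with `t₂ − t₁ ∉ 𝓡`** the reach sets of the two grains are disjoint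
(`reachSet_disjoint_iff`, `…WalkReach`), hence (`twoSlabAdhesion_stackLedger_offReach`, `…StackLedgerOffReach`) the cell
inequality holds at FULL charge `½(κ₁+κ₂) ≥ 1` for ARBITRARY fillings, and:
* `twoSlabLedgerAt_offReach` — `TwoSlabLedgerAt (½(κ₁+κ₂)) A₁ t₁ A₂ t₂` (the line's stub matrix per pair; also lane F's
  cell inequality for CO-AXIAL pairs at charge ≥ 1 ≥ ½ sin θ, translation pairs included);
* `genericWallFloorAtCharge_offReach`, **`genericWallFloorAt_offReach`** — the route decl's matrix per pair, `c₀ = 1`;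
* `genericWallFloorAt_offReach_chain` — the same with `Mᵢ = chainFrames`, hypothesis spelled on `t₂ − t₁`.
READING (R41W-ARCH-g7 §5, «an arriving walker pins the relative coset»): arrival, and every cross-grain coincidence of
walker ends, needs `t₂ − t₁ ∈ 𝓡`; off `𝓡` nothing of the riser problem exists.  The remaining core of lane G is therefore
the REGISTERED translations of the ≈5 % residual orientations (`GenericWallFloorCoreResidualTilt`) — exactly where
coherent lamellae and their T = 0 risers (rows R-G2H, `…RiserEndRows`) live.
WHAT THIS IS NOT: not the stub (registered translations open); no countability lemma is proved here; F-C1 not moved.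
-/

noncomputable section

namespace Summit.Ventures.Crystal3D.Theorems

open Summit.Ventures.Crystal3D Finset
open Literature.MathematicalPhysics.StatisticalMechanics (fccStacking barlowStacking IsHaggSeq contactDeficiency)
open scoped InnerProductSpace

open scoped Classical in
/-- **The line's stub matrix per pair at full charge, off the registry set.**  Any frames, steep slots `u₁` (up) / `u₂`
(down), frame sets `Mᵢ` containing the frames of all sound well-formed stacks over the bottoms, disjoint reach sets;
modulo `ExactOnly`(C12-55) and `StarPairFar`. -/
theorem twoSlabLedgerAt_offReach
    {s₀ : EuclideanSpace ℝ (Fin 3)} (hs₀ : s₀ ∈ fccSlots)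
    (hcert : ExactOnly 0 (fccSlots.filter fun w => 0 < ⟪w, s₀⟫_ℝ)) (hfar : StarPairFar)
    (A₁ : EuclideanSpace ℝ (Fin 3) ≃ₗᵢ[ℝ] EuclideanSpace ℝ (Fin 3)) (t₁ : EuclideanSpace ℝ (Fin 3))
    (A₂ : EuclideanSpace ℝ (Fin 3) ≃ₗᵢ[ℝ] EuclideanSpace ℝ (Fin 3)) (t₂ : EuclideanSpace ℝ (Fin 3))
    {u₁ : EuclideanSpace ℝ (Fin 3)} (hu₁ : u₁ ∈ fccSlots)
    (hsteep₁ : Real.sqrt 2 / 2 ≤ ⟪A₁ u₁, EuclideanSpace.single (2 : Fin 3) (1 : ℝ)⟫_ℝ)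
    {u₂ : EuclideanSpace ℝ (Fin 3)} (hu₂ : u₂ ∈ fccSlots)
    (hsteep₂ : ⟪A₂ u₂, EuclideanSpace.single (2 : Fin 3) (1 : ℝ)⟫_ℝ ≤ -(Real.sqrt 2 / 2))
    (M₁ M₂ : Set (EuclideanSpace ℝ (Fin 3) ≃ₗᵢ[ℝ] EuclideanSpace ℝ (Fin 3)))
    (hM₁ : ∀ stk : List WalkEntry, StackSound (EuclideanSpace.single (2 : Fin 3) (1 : ℝ)) stk →
      StackWF (EuclideanSpace.single (2 : Fin 3) (1 : ℝ)) stk → stk.getLast? = some ⟨A₁, u₁, 0⟩ →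
      ∀ e ∈ stk, e.frame ∈ M₁)
    (hM₂ : ∀ stk : List WalkEntry, StackSound (-EuclideanSpace.single (2 : Fin 3) (1 : ℝ)) stk →
      StackWF (-EuclideanSpace.single (2 : Fin 3) (1 : ℝ)) stk → stk.getLast? = some ⟨A₂, u₂, 0⟩ →
      ∀ e ∈ stk, e.frame ∈ M₂)
    (hoff : ∀ y ∈ reachSet A₁ t₁ M₁, y ∉ reachSet A₂ t₂ M₂) :
    TwoSlabLedgerAt ((Real.sqrt 2 * |⟪A₁ u₁, EuclideanSpace.single (2 : Fin 3) (1 : ℝ)⟫_ℝ| +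
      Real.sqrt 2 * |⟪A₂ u₂, EuclideanSpace.single (2 : Fin 3) (1 : ℝ)⟫_ℝ|) / 2) A₁ t₁ A₂ t₂ :=
  twoSlabAdhesion_stackLedger_offReach hs₀ hcert (doubleStarCoaxialAt_of_starPairFar hfar)
    (capPairCoaxial_of_starPairFar hfar) A₁ t₁ A₂ t₂ hu₁ hsteep₁ hu₂ hsteep₂ M₁ M₂ hM₁ hM₂ hoff

open scoped Classical in
/-- **The route decl's matrix per pair at charge `½(κ₁+κ₂)`, off the registry set** (skeleton composition
`genericWallFloorAtCharge_of_ledger`). -/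
theorem genericWallFloorAtCharge_offReach
    {s₀ : EuclideanSpace ℝ (Fin 3)} (hs₀ : s₀ ∈ fccSlots)
    (hcert : ExactOnly 0 (fccSlots.filter fun w => 0 < ⟪w, s₀⟫_ℝ)) (hfar : StarPairFar)
    (A₁ : EuclideanSpace ℝ (Fin 3) ≃ₗᵢ[ℝ] EuclideanSpace ℝ (Fin 3)) (t₁ : EuclideanSpace ℝ (Fin 3))
    (A₂ : EuclideanSpace ℝ (Fin 3) ≃ₗᵢ[ℝ] EuclideanSpace ℝ (Fin 3)) (t₂ : EuclideanSpace ℝ (Fin 3))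
    {u₁ : EuclideanSpace ℝ (Fin 3)} (hu₁ : u₁ ∈ fccSlots)
    (hsteep₁ : Real.sqrt 2 / 2 ≤ ⟪A₁ u₁, EuclideanSpace.single (2 : Fin 3) (1 : ℝ)⟫_ℝ)
    {u₂ : EuclideanSpace ℝ (Fin 3)} (hu₂ : u₂ ∈ fccSlots)
    (hsteep₂ : ⟪A₂ u₂, EuclideanSpace.single (2 : Fin 3) (1 : ℝ)⟫_ℝ ≤ -(Real.sqrt 2 / 2))
    (M₁ M₂ : Set (EuclideanSpace ℝ (Fin 3) ≃ₗᵢ[ℝ] EuclideanSpace ℝ (Fin 3)))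
    (hM₁ : ∀ stk : List WalkEntry, StackSound (EuclideanSpace.single (2 : Fin 3) (1 : ℝ)) stk →
      StackWF (EuclideanSpace.single (2 : Fin 3) (1 : ℝ)) stk → stk.getLast? = some ⟨A₁, u₁, 0⟩ →
      ∀ e ∈ stk, e.frame ∈ M₁)
    (hM₂ : ∀ stk : List WalkEntry, StackSound (-EuclideanSpace.single (2 : Fin 3) (1 : ℝ)) stk →
      StackWF (-EuclideanSpace.single (2 : Fin 3) (1 : ℝ)) stk → stk.getLast? = some ⟨A₂, u₂, 0⟩ →
      ∀ e ∈ stk, e.frame ∈ M₂)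
    (hoff : ∀ y ∈ reachSet A₁ t₁ M₁, y ∉ reachSet A₂ t₂ M₂) :
    GenericWallFloorAtCharge ((Real.sqrt 2 * |⟪A₁ u₁, EuclideanSpace.single (2 : Fin 3) (1 : ℝ)⟫_ℝ| +
      Real.sqrt 2 * |⟪A₂ u₂, EuclideanSpace.single (2 : Fin 3) (1 : ℝ)⟫_ℝ|) / 2) A₁ t₁ A₂ t₂ :=
  genericWallFloorAtCharge_of_ledger _ A₁ t₁ A₂ t₂
    (twoSlabLedgerAt_offReach hs₀ hcert hfar A₁ t₁ A₂ t₂ hu₁ hsteep₁ hu₂ hsteep₂ M₁ M₂ hM₁ hM₂ hoff)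

open scoped Classical in
/-- **`GenericWallFloorAt` (the route decl's matrix, `c₀ = 1`) for every pair whose reach sets are disjoint**, modulo
`ExactOnly`(C12-55) and `StarPairFar`: `½(κ₁ + κ₂) ≥ 1` at steep slots. -/
theorem genericWallFloorAt_offReach
    {s₀ : EuclideanSpace ℝ (Fin 3)} (hs₀ : s₀ ∈ fccSlots)
    (hcert : ExactOnly 0 (fccSlots.filter fun w => 0 < ⟪w, s₀⟫_ℝ)) (hfar : StarPairFar)
    (A₁ : EuclideanSpace ℝ (Fin 3) ≃ₗᵢ[ℝ] EuclideanSpace ℝ (Fin 3)) (t₁ : EuclideanSpace ℝ (Fin 3))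
    (A₂ : EuclideanSpace ℝ (Fin 3) ≃ₗᵢ[ℝ] EuclideanSpace ℝ (Fin 3)) (t₂ : EuclideanSpace ℝ (Fin 3))
    {u₁ : EuclideanSpace ℝ (Fin 3)} (hu₁ : u₁ ∈ fccSlots)
    (hsteep₁ : Real.sqrt 2 / 2 ≤ ⟪A₁ u₁, EuclideanSpace.single (2 : Fin 3) (1 : ℝ)⟫_ℝ)
    {u₂ : EuclideanSpace ℝ (Fin 3)} (hu₂ : u₂ ∈ fccSlots)
    (hsteep₂ : ⟪A₂ u₂, EuclideanSpace.single (2 : Fin 3) (1 : ℝ)⟫_ℝ ≤ -(Real.sqrt 2 / 2))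
    (M₁ M₂ : Set (EuclideanSpace ℝ (Fin 3) ≃ₗᵢ[ℝ] EuclideanSpace ℝ (Fin 3)))
    (hM₁ : ∀ stk : List WalkEntry, StackSound (EuclideanSpace.single (2 : Fin 3) (1 : ℝ)) stk →
      StackWF (EuclideanSpace.single (2 : Fin 3) (1 : ℝ)) stk → stk.getLast? = some ⟨A₁, u₁, 0⟩ →
      ∀ e ∈ stk, e.frame ∈ M₁)
    (hM₂ : ∀ stk : List WalkEntry, StackSound (-EuclideanSpace.single (2 : Fin 3) (1 : ℝ)) stk →
      StackWF (-EuclideanSpace.single (2 : Fin 3) (1 : ℝ)) stk → stk.getLast? = some ⟨A₂, u₂, 0⟩ →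
      ∀ e ∈ stk, e.frame ∈ M₂)
    (hoff : ∀ y ∈ reachSet A₁ t₁ M₁, y ∉ reachSet A₂ t₂ M₂) :
    GenericWallFloorAt A₁ t₁ A₂ t₂ := by
  have hκ₁ := one_le_flux_of_steep (A := A₁) (u := u₁) (le_trans hsteep₁ (le_abs_self _))
  have hκ₂ : 1 ≤ Real.sqrt 2 * |⟪A₂ u₂, EuclideanSpace.single (2 : Fin 3) (1 : ℝ)⟫_ℝ| := by
    refine one_le_flux_of_steep (A := A₂) (u := u₂) ?_
    rw [abs_of_nonpos (by linarith only [hsteep₂, Real.sqrt_nonneg 2] :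
      ⟪A₂ u₂, EuclideanSpace.single (2 : Fin 3) (1 : ℝ)⟫_ℝ ≤ 0)]
    linarith only [hsteep₂]
  exact genericWallFloorAt_of_charge_one (genericWallFloorAtCharge_mono (by linarith only [hκ₁, hκ₂])
    (genericWallFloorAtCharge_offReach hs₀ hcert hfar A₁ t₁ A₂ t₂ hu₁ hsteep₁ hu₂ hsteep₂ M₁ M₂ hM₁ hM₂ hoff))

open scoped Classical in
/-- **`GenericWallFloorAt` for every relative translation off the registry set of the forced rays**:
`t₂ − t₁ ∉ A₁·Λ₀ − A₂·Λ₀ + reachGroup (chainFrames e₃ A₁ u₁) − reachGroup (chainFrames (−e₃) A₂ u₂)` (a countable set: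
each `chainFrames` is the base frame plus two `ℕ`-indexed forced rays), ANY frames `A₁, A₂`, steep slots `u₁`/`u₂`;
modulo `ExactOnly`(C12-55) and `StarPairFar`. -/
theorem genericWallFloorAt_offReach_chain
    {s₀ : EuclideanSpace ℝ (Fin 3)} (hs₀ : s₀ ∈ fccSlots)
    (hcert : ExactOnly 0 (fccSlots.filter fun w => 0 < ⟪w, s₀⟫_ℝ)) (hfar : StarPairFar)
    (A₁ : EuclideanSpace ℝ (Fin 3) ≃ₗᵢ[ℝ] EuclideanSpace ℝ (Fin 3)) (t₁ : EuclideanSpace ℝ (Fin 3))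
    (A₂ : EuclideanSpace ℝ (Fin 3) ≃ₗᵢ[ℝ] EuclideanSpace ℝ (Fin 3)) (t₂ : EuclideanSpace ℝ (Fin 3))
    {u₁ : EuclideanSpace ℝ (Fin 3)} (hu₁ : u₁ ∈ fccSlots)
    (hsteep₁ : Real.sqrt 2 / 2 ≤ ⟪A₁ u₁, EuclideanSpace.single (2 : Fin 3) (1 : ℝ)⟫_ℝ)
    {u₂ : EuclideanSpace ℝ (Fin 3)} (hu₂ : u₂ ∈ fccSlots)
    (hsteep₂ : ⟪A₂ u₂, EuclideanSpace.single (2 : Fin 3) (1 : ℝ)⟫_ℝ ≤ -(Real.sqrt 2 / 2))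
    (hgen : ∀ x₁ ∈ fccStacking 1 (Real.sqrt (2 / 3)), ∀ x₂ ∈ fccStacking 1 (Real.sqrt (2 / 3)),
      ∀ v₁ ∈ reachGroup (chainFrames (EuclideanSpace.single (2 : Fin 3) (1 : ℝ)) A₁ u₁),
      ∀ v₂ ∈ reachGroup (chainFrames (-EuclideanSpace.single (2 : Fin 3) (1 : ℝ)) A₂ u₂),
        t₂ - t₁ ≠ A₁ x₁ - A₂ x₂ + v₁ - v₂) :
    GenericWallFloorAt A₁ t₁ A₂ t₂ :=
  genericWallFloorAt_offReach hs₀ hcert hfar A₁ t₁ A₂ t₂ hu₁ hsteep₁ hu₂ hsteep₂ _ _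
    (fun _ hS hW hlast => frame_mem_chainFrames_of_stack hS hW hlast)
    (fun _ hS hW hlast => frame_mem_chainFrames_of_stack hS hW hlast)
    (reachSet_disjoint_iff.2 hgen)

end Summit.Ventures.Crystal3D.Theorems

end
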